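import Summits.HubbardSuperconductivity.HubbardSuperconductivity.Theorems.AnisotropyChordDressHalfFilledSecondOrderSandwich
import Summits.HubbardSuperconductivity.HubbardSuperconductivity.Theorems.AnisotropyChordDressHalfFilledSecondOrderLowerPlaquette
import HarnessLib

/-!
# Crux `DressHalfFilled` (stmt-HubbardSuperconductivity-8148, routes `AnisotropyChord` / `LevyLogBootstrap`), stub 3
# `stub_dressHalfFilled`: THE SECOND-ORDER SELECTION PRINCIPLE — the plaquette component of every low-energy state of
# `H_in + t' T` nearly minimises the effective XXZ energy (fixed `L`)

Helper file (`--supports stmt-HubbardSuperconductivity-8148`), continuing `…SecondOrderSandwich` / `…SecondOrderLowerPlaquette`.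

* `secondOrder_gain_ge_of_lowEnergy` — ABSTRACT: in the gapped-sector setting of `second_order_sandwich`, a unit `ψ ∈ K` with
  energy `≤ E₀ − t²σ₀ + C t³`, `t > 0`, has second-order gain `Re⟨T Pψ, S T Pψ⟩ ≥ (1 − tτ/g)·(σ₀ − C·t)`;
* `plaquette_lowEnergy_xxz_form_le` — THE PLAQUETTE TORUS (`M ≥ 3`, `PlaquetteData U`, `N_b ≤ M²`, `k` of clause (d), sector gap
  `g` and form bound `τ` as hypotheses — discharged by existence in `…SecondOrderLowerGap`): for `0 < t'`, `t'τ < g` and every unit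
  `ψ` of the electron sector `(L² − 2N_b, 0)` with `Re⟨ψ, (H_in + t'T)ψ⟩ ≤ E₀(N_b) − t'²σ₀ + C t'³` there is a spin vector `φ` of
  the boson sector with **`P ψ = Φ φ`** and **`Re⟨φ, (2J·XXZ(Δ_eff) + k(N_b)·1) φ⟩ ≤ −(1 − t'τ/g)(σ₀ − C t')`**.
  With `σ₀ = −e_XXZ` (the value delivered by `…SecondOrderUpperXXZ` at an XXZ sector ground state) this says: the plaquette component
  of every state within `O(t'³)` of the ground energy — in particular of every sector ground state — has XXZ energy
  `≤ e_XXZ + O_L(t')` (its norm being `1 − O(t'²)` by `…SecondOrderTransverse`), hence lies `O_L(√t')`-close to the XXZ ground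
  multiplet by the XXZ sector gap (`exists_gap_groundProj_form`). This is the fixed-`L` ground-state CONCENTRATION behind the
  non-uniform (`t₀ = t₀(L)`) form of the anchor; the uniform statement is the open content of stub 3.

HONEST LABEL: fixed-`L` perturbation theory; no order statement is made here; nothing uniform in `L`; no crux and no summit
statement is proved. Sources: T. Kato (1966) II-§2.3 [Kato1966]; W.-F. Tsai, S. A. Kivelson, PRB 73 (2006) 214510, App. A
[TsaiKivelson2006]. No definition and no named fact is introduced; sorry-free.
-/

noncomputable section

-- `dupNamespace`: the summit and the problem are both named `HubbardSuperconductivity` (layout D-0022)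
set_option linter.dupNamespace false

namespace Summit.HubbardSuperconductivity.HubbardSuperconductivity.Theorems.AnisotropyChord.DressSecond

open Matrix Literature.MathematicalPhysics.QuantumLattice Literature.Probability.LatticeModels
open Literature.MathematicalPhysics.QuantumLattice.TorusPlaquette
open Summit.HubbardSuperconductivity.HubbardSuperconductivity.Theorems.LevyLogBootstrap
  (PlaquetteData dictionaryMap_kernel_clause_of_unique dictionary_exhaustion)
open scoped ComplexOrder

section Abstract

variable {m : Type*} [Fintype m] [DecidableEq m]

/-- **Second-order gain of a low-energy state.** In the setting of `second_order_sandwich`, for `t > 0` and a unit `ψ ∈ K`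
with `Re⟨ψ, (H₀ + tT)ψ⟩ ≤ E₀ − t²σ₀ + C t³`: `(1 − tτ/g)(σ₀ − C t) ≤ Re⟨T Pψ, S T Pψ⟩`. [folklore] -/
theorem secondOrder_gain_ge_of_lowEnergy {H₀ T : Matrix m m ℂ} (hH₀ : H₀.IsHermitian) (hT : T.IsHermitian)
    (K : Submodule ℂ (m → ℂ)) {E₀ g τ σ₀ C t : ℝ}
    (hKT : ∀ v ∈ K, T *ᵥ v ∈ K) (hKS : ∀ v ∈ K, reducedResolvent H₀ E₀ *ᵥ v ∈ K)
    (hKP : ∀ v ∈ K, eigenProj H₀ E₀ *ᵥ v ∈ K)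
    (hg : 0 < g)
    (hgap : ∀ v ∈ K, eigenProj H₀ E₀ *ᵥ v = 0 →
      g * (star v ⬝ᵥ v).re ≤ (star v ⬝ᵥ (H₀ *ᵥ v)).re - E₀ * (star v ⬝ᵥ v).re)
    (hτ : ∀ v ∈ K, |(star v ⬝ᵥ (T *ᵥ v)).re| ≤ τ * (star v ⬝ᵥ v).re)
    (hPTP : ∀ v ∈ K, (star (eigenProj H₀ E₀ *ᵥ v) ⬝ᵥ (T *ᵥ (eigenProj H₀ E₀ *ᵥ v))).re = 0)
    (ht0 : 0 < t) (htg : t * τ < g)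
    {ψ : m → ℂ} (hψ : ψ ∈ K) (hψ1 : star ψ ⬝ᵥ ψ = 1)
    (hR : (star ψ ⬝ᵥ ((H₀ + (t : ℂ) • T) *ᵥ ψ)).re ≤ E₀ - t ^ 2 * σ₀ + C * t ^ 3) :
    (1 - t * τ / g) * (σ₀ - C * t) ≤
      (star (T *ᵥ (eigenProj H₀ E₀ *ᵥ ψ)) ⬝ᵥ (reducedResolvent H₀ E₀ *ᵥ (T *ᵥ (eigenProj H₀ E₀ *ᵥ ψ)))).re := by
  have hs := second_order_sandwich hH₀ hT K hKT hKS hKP hg hgap hτ hPTP ht0.le htg hψ hψ1 hR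
  set lam : ℝ := 1 - t * τ / g with hlam
  have hlam0 : 0 < lam := by rw [hlam, sub_pos, div_lt_one hg]; exact htg
  set σ : ℝ := (star (T *ᵥ (eigenProj H₀ E₀ *ᵥ ψ)) ⬝ᵥ
    (reducedResolvent H₀ E₀ *ᵥ (T *ᵥ (eigenProj H₀ E₀ *ᵥ ψ)))).re with hσ
  have hnu : 0 ≤ (star ((ψ - eigenProj H₀ E₀ *ᵥ ψ) +
        ((t / lam : ℝ) : ℂ) • reducedResolvent H₀ E₀ *ᵥ (T *ᵥ (eigenProj H₀ E₀ *ᵥ ψ))) ⬝ᵥ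
      ((ψ - eigenProj H₀ E₀ *ᵥ ψ) +
        ((t / lam : ℝ) : ℂ) • reducedResolvent H₀ E₀ *ᵥ (T *ᵥ (eigenProj H₀ E₀ *ᵥ ψ)))).re :=
    (Complex.nonneg_iff.mp (dotProduct_star_self_nonneg _)).1
  -- `0 ≤ λ g ‖u‖² ≤ t²(σ/λ − σ₀) + C t³`, divide by `t² > 0`
  have h1 : 0 ≤ t ^ 2 * (σ / lam - σ₀) + C * t ^ 3 :=
    le_trans (mul_nonneg (mul_nonneg hlam0.le hg.le) hnu) hs
  have ht2 : 0 < t ^ 2 := by positivity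
  have h2 : 0 ≤ σ / lam - σ₀ + C * t := by
    have e : t ^ 2 * (σ / lam - σ₀) + C * t ^ 3 = t ^ 2 * (σ / lam - σ₀ + C * t) := by ring
    rw [e] at h1
    by_contra hneg
    push Not at hneg
    have := mul_neg_of_pos_of_neg ht2 hneg
    linarith
  have h3 : lam * (σ₀ - C * t) ≤ σ := by
    have : σ₀ - C * t ≤ σ / lam := by linarith
    calc lam * (σ₀ - C * t) ≤ lam * (σ / lam) := mul_le_mul_of_nonneg_left this hlam0.le
      _ = σ := by field_simp
  exact h3

end Abstract

section Plaquette

variable {M : ℕ} [NeZero M]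

set_option linter.style.longLine false in
/-- **Selection principle on the plaquette torus.** `M ≥ 3`, `PlaquetteData U`; with the `k` of clause (d): for every
`N_b ≤ M²`, every sector gap `g > 0` of `H_in − E₀(N_b)` on `K ∩ ker P` and form bound `τ` of `T` on `K = szSector (L² − 2N_b) 0`,
every `0 < t'` with `t'τ < g`, and every unit `ψ ∈ K` with `Re⟨ψ, (H_in + t'T)ψ⟩ ≤ E₀(N_b) − t'²σ₀ + C t'³`, there is a spin
vector `φ` of the boson sector `S^z_tot = N_b − M²/2` with `P ψ = Φ φ` and
`Re⟨φ, (2J·XXZ(Δ_eff) + k(N_b)·1) φ⟩ ≤ −(1 − t'τ/g)·(σ₀ − C t')`. Kato (1966) II-§2.3; Tsai–Kivelson (2006) App. A. [folklore] -/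
theorem plaquette_lowEnergy_xxz_form_le (hM : 3 ≤ M) {U : ℝ} (hPD : PlaquetteData U) :
    ∃ k : ℕ → ℝ, ∀ (Nb : ℕ), Nb ≤ M ^ 2 → ∀ (g τ : ℝ), 0 < g →
      (∀ v : Fock (Orb (FermionTorus 2 (2 * M))), v ∈ szSector (Λ := FermionTorus 2 (2 * M)) ((2 * M) ^ 2 - 2 * Nb) 0 →
        eigenProj (hamiltonian (fermionTorusGraph 2 (2 * M) \
          SimpleGraph.comap (fun x : FermionTorus 2 (2 * M) => fun i : Fin 2 => ((ofLex x) i : ℕ) / 2) ⊤) 1 U)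
          (((M : ℝ) ^ 2 - Nb) * plaquetteEnergy U 0 + Nb * plaquetteEnergy U 2) *ᵥ v = 0 →
        g * (star v ⬝ᵥ v).re ≤ (star v ⬝ᵥ (hamiltonian (fermionTorusGraph 2 (2 * M) \
          SimpleGraph.comap (fun x : FermionTorus 2 (2 * M) => fun i : Fin 2 => ((ofLex x) i : ℕ) / 2) ⊤) 1 U *ᵥ v)).re -
          (((M : ℝ) ^ 2 - Nb) * plaquetteEnergy U 0 + Nb * plaquetteEnergy U 2) * (star v ⬝ᵥ v).re) →
      (∀ v : Fock (Orb (FermionTorus 2 (2 * M))), v ∈ szSector (Λ := FermionTorus 2 (2 * M)) ((2 * M) ^ 2 - 2 * Nb) 0 →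
        |(star v ⬝ᵥ (hamiltonian (fermionTorusGraph 2 (2 * M) ⊓
          SimpleGraph.comap (fun x : FermionTorus 2 (2 * M) => fun i : Fin 2 => ((ofLex x) i : ℕ) / 2) ⊤) 1 0 *ᵥ v)).re| ≤
          τ * (star v ⬝ᵥ v).re) →
      ∀ (σ₀ C t' : ℝ), 0 < t' → t' * τ < g →
      ∀ ψ : Fock (Orb (FermionTorus 2 (2 * M))), ψ ∈ szSector (Λ := FermionTorus 2 (2 * M)) ((2 * M) ^ 2 - 2 * Nb) 0 →
        star ψ ⬝ᵥ ψ = 1 →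
        (star ψ ⬝ᵥ ((hamiltonian (fermionTorusGraph 2 (2 * M) \
            SimpleGraph.comap (fun x : FermionTorus 2 (2 * M) => fun i : Fin 2 => ((ofLex x) i : ℕ) / 2) ⊤) 1 U +
          (t' : ℂ) • hamiltonian (fermionTorusGraph 2 (2 * M) ⊓
            SimpleGraph.comap (fun x : FermionTorus 2 (2 * M) => fun i : Fin 2 => ((ofLex x) i : ℕ) / 2) ⊤) 1 0) *ᵥ ψ)).re ≤
          (((M : ℝ) ^ 2 - Nb) * plaquetteEnergy U 0 + Nb * plaquetteEnergy U 2) - t' ^ 2 * σ₀ + C * t' ^ 3 →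
      ∃ φ : TensorIndex (TorusSite 2 M) 2 → ℂ,
        φ ∈ spinZSector (Λ := TorusSite 2 M) 1 ((Nb : ℝ) - (M : ℝ) ^ 2 / 2) ∧
        eigenProj (hamiltonian (fermionTorusGraph 2 (2 * M) \
          SimpleGraph.comap (fun x : FermionTorus 2 (2 * M) => fun i : Fin 2 => ((ofLex x) i : ℕ) / 2) ⊤) 1 U)
          (((M : ℝ) ^ 2 - Nb) * plaquetteEnergy U 0 + Nb * plaquetteEnergy U 2) *ᵥ ψ = dictionaryMap M U *ᵥ φ ∧
        (star φ ⬝ᵥ ((((2 * (plaquettePairCouplings U).J : ℝ) : ℂ) •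
            xxzHamiltonian 1 (torusGraph 2 M) (-1) (plaquettePairCouplings U).ΔEff + ((k Nb : ℝ) : ℂ) • 1) *ᵥ φ)).re ≤
          -((1 - t' * τ / g) * (σ₀ - C * t')) := by
  have hM2 : 2 ≤ M := le_trans (by norm_num) hM
  obtain ⟨⟨hJ, -, -⟩, -, ⟨-, -, hW3⟩, hW4a, hW4b, hW5a, hW5b⟩ := hPD
  obtain ⟨k, hk⟩ := dictionaryMap_kernel_clause_of_unique (M := M) hJ.ne' hW4a hW4b hM
  refine ⟨k, fun Nb hNb g τ hg hgap hτ σ₀ C t' ht0 htg ψ hψ hψ1 hR => ?_⟩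
  obtain ⟨-, hexh⟩ := dictionary_exhaustion hM2 U hW3 hW4a hW4b hW5a hW5b hNb
  have hH₀ := (hamiltonian_isHermitian_and_commute_holds (fermionTorusGraph 2 (2 * M) \
    SimpleGraph.comap (fun x : FermionTorus 2 (2 * M) => fun i : Fin 2 => ((ofLex x) i : ℕ) / 2) ⊤) 1 U).1
  have hT := (hamiltonian_isHermitian_and_commute_holds (fermionTorusGraph 2 (2 * M) ⊓
    SimpleGraph.comap (fun x : FermionTorus 2 (2 * M) => fun i : Fin 2 => ((ofLex x) i : ℕ) / 2) ⊤) 1 0).1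
  -- `P ψ` is a dictionary state
  have hPψK : eigenProj (hamiltonian (fermionTorusGraph 2 (2 * M) \
          SimpleGraph.comap (fun x : FermionTorus 2 (2 * M) => fun i : Fin 2 => ((ofLex x) i : ℕ) / 2) ⊤) 1 U)
          (((M : ℝ) ^ 2 - Nb) * plaquetteEnergy U 0 + Nb * plaquetteEnergy U 2) *ᵥ ψ ∈
      szSector (Λ := FermionTorus 2 (2 * M)) ((2 * M) ^ 2 - 2 * Nb) 0 :=
    eigenProj_mulVec_mem_szSector _ 1 U _ hψ
  obtain ⟨φ, hφK, hφ⟩ := hexh _ hPψK (mulVec_eigenProj_mulVec hH₀ _ ψ)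
  -- no first-order term on `P K` (every `P v` is a dictionary state)
  have hPTP : ∀ v ∈ szSector (Λ := FermionTorus 2 (2 * M)) ((2 * M) ^ 2 - 2 * Nb) 0,
      (star (eigenProj (hamiltonian (fermionTorusGraph 2 (2 * M) \
          SimpleGraph.comap (fun x : FermionTorus 2 (2 * M) => fun i : Fin 2 => ((ofLex x) i : ℕ) / 2) ⊤) 1 U)
          (((M : ℝ) ^ 2 - Nb) * plaquetteEnergy U 0 + Nb * plaquetteEnergy U 2) *ᵥ v) ⬝ᵥ
        (hamiltonian (fermionTorusGraph 2 (2 * M) ⊓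
          SimpleGraph.comap (fun x : FermionTorus 2 (2 * M) => fun i : Fin 2 => ((ofLex x) i : ℕ) / 2) ⊤) 1 0 *ᵥ
          (eigenProj (hamiltonian (fermionTorusGraph 2 (2 * M) \
            SimpleGraph.comap (fun x : FermionTorus 2 (2 * M) => fun i : Fin 2 => ((ofLex x) i : ℕ) / 2) ⊤) 1 U)
            (((M : ℝ) ^ 2 - Nb) * plaquetteEnergy U 0 + Nb * plaquetteEnergy U 2) *ᵥ v))).re = 0 := by
    intro v hv
    obtain ⟨φ', -, hφ'⟩ := hexh _ (eigenProj_mulVec_mem_szSector _ 1 U _ hv) (mulVec_eigenProj_mulVec hH₀ _ v)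
    rw [hφ', DressFirst.star_dictionaryMap_mulVec_dotProduct_hamiltonian_inter hM2 U φ' φ', Complex.zero_re]
  have hgain := secondOrder_gain_ge_of_lowEnergy hH₀ hT _
    (fun v hv => hamiltonian_mulVec_mem_szSector _ 1 0 hv)
    (fun v hv => reducedResolvent_mulVec_mem_szSector _ 1 U _ hv)
    (fun v hv => eigenProj_mulVec_mem_szSector _ 1 U _ hv)
    hg hgap hτ hPTP ht0 htg hψ hψ1 hR
  refine ⟨φ, hφK, hφ, ?_⟩
  rw [hφ] at hgain
  -- translate the gain into the XXZ form by clause (d)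
  have hd := hk Nb hNb φ φ hφK hφK
  have hmove : star (dictionaryMap M U *ᵥ φ) ⬝ᵥ ((hamiltonian (fermionTorusGraph 2 (2 * M) ⊓
          SimpleGraph.comap (fun x : FermionTorus 2 (2 * M) => fun i : Fin 2 => ((ofLex x) i : ℕ) / 2) ⊤) 1 0 *
          reducedResolvent (hamiltonian (fermionTorusGraph 2 (2 * M) \
            SimpleGraph.comap (fun x : FermionTorus 2 (2 * M) => fun i : Fin 2 => ((ofLex x) i : ℕ) / 2) ⊤) 1 U)
            (((M : ℝ) ^ 2 - (Nb : ℝ)) * (plaquettePairCouplings U).E 0 + (Nb : ℝ) * (plaquettePairCouplings U).E 2) *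
          hamiltonian (fermionTorusGraph 2 (2 * M) ⊓
            SimpleGraph.comap (fun x : FermionTorus 2 (2 * M) => fun i : Fin 2 => ((ofLex x) i : ℕ) / 2) ⊤) 1 0) *ᵥ
        (dictionaryMap M U *ᵥ φ)) =
      star (hamiltonian (fermionTorusGraph 2 (2 * M) ⊓
          SimpleGraph.comap (fun x : FermionTorus 2 (2 * M) => fun i : Fin 2 => ((ofLex x) i : ℕ) / 2) ⊤) 1 0 *ᵥ
            (dictionaryMap M U *ᵥ φ)) ⬝ᵥ
        (reducedResolvent (hamiltonian (fermionTorusGraph 2 (2 * M) \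
            SimpleGraph.comap (fun x : FermionTorus 2 (2 * M) => fun i : Fin 2 => ((ofLex x) i : ℕ) / 2) ⊤) 1 U)
            (((M : ℝ) ^ 2 - Nb) * plaquetteEnergy U 0 + Nb * plaquetteEnergy U 2) *ᵥ
          (hamiltonian (fermionTorusGraph 2 (2 * M) ⊓
            SimpleGraph.comap (fun x : FermionTorus 2 (2 * M) => fun i : Fin 2 => ((ofLex x) i : ℕ) / 2) ⊤) 1 0 *ᵥ
              (dictionaryMap M U *ᵥ φ))) := by
    rw [← mulVec_mulVec, ← mulVec_mulVec, RayleighBottom.star_dotProduct_mulVec_eq, hT.eq]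
    rfl
  rw [hmove] at hd
  rw [hd, Complex.neg_re] at hgain
  linarith

end Plaquette

end Summit.HubbardSuperconductivity.HubbardSuperconductivity.Theorems.AnisotropyChord.DressSecond

end
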